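import Mathlib.RingTheory.Polynomial.Eisenstein.Basic
import Mathlib.RingTheory.Polynomial.GaussLemma
import Mathlib.RingTheory.RootsOfUnity.PrimitiveRoots
import Mathlib.FieldTheory.IntermediateField.Adjoin.Basic
import Mathlib.NumberTheory.NumberField.Basic
import Mathlib.Data.Nat.Prime.Int
import Mathlib.Algebra.CharP.Algebra
import HarnessLib

/-!
# The layer polynomials `Ψ_n` of the cyclotomic `ℤ₂`-tower: `Ψ_0 = X`, `Ψ_{n+1} = Ψ_n² − 2`
# (`Ψ_1 = X² − 2`, `Ψ_2 = X⁴ − 4X² + 2`, `Ψ_3 = X⁸ − 8X⁶ + 20X⁴ − 16X² + 2`, …; root `2cos(π/2^{n+1}) = ζ_{2^{n+2}} + ζ_{2^{n+2}}⁻¹`)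

Topic `NumberTheory/NumberFields` (namespace = path, grouped under `NestedSqrtTwo`). THEOREM-ONLY file (no definition, no named
fact, no `sorry`), written by the prover seat `cruxlead-stmt-BirchSwinnertonDyer-19573-w2` GEN 11 (cell `bsd-2adic`; `--supports`
stmt-BirchSwinnertonDyer-19573; closes nothing).  Generalises to every layer `n` the polynomial algebra that GEN 9/10 of this seat
did by hand for `X² − 2` (`NarrowFukudaCertificateLayerModels`) and `X⁴ − 4X² + 2` (`NarrowFukudaCertificateLayerTwoModel`).

NO NEW DEFINITION: the `n`-th layer polynomial is written `((X ^ 2 - C 2 : R[X]).comp)^[n] X` (the `n`-th iterate of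
`q ↦ q² − 2` applied to `X`), and «`θ` is a root of `Ψ_n`» is written `(fun x => x ^ 2 - 2)^[n] θ = 0` (`NestedSqrtTwo.aeval_eq_iterate`).

* §1 (any commutative ring) `iterate_succ` (`Ψ_{n+1} = Ψ_n² − 2`), `aeval_eq_iterate`, `map_iterate` (ring homs commute with
  `x ↦ x² − 2`), `map_eq` (base change), `monic`, `natDegree_eq` (`= 2ⁿ`).
* §2 (over `ℤ`) `exists_eq_X_pow_add_C_two_mul` (`Ψ_{n+1} = X^{2^{n+1}} + 2q` with `q(0)² = 1`), so `Ψ_{n+1}` is Eisenstein at `2`: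
  `isEisensteinAt_two`, **`irreducible_int`**, **`irreducible_rat`** (Gauss); `minpoly_rat_eq` (the minimal polynomial over `ℚ` of any
  root in any field is `Ψ_n`), `finrank_rat_adjoin_eq` (`[ℚ(θ):ℚ] = 2ⁿ`).
* §3 (over a number field `K` of ODD degree) **`minpoly_eq_of_odd_finrank`**: the minimal polynomial over `K` of ANY root of `Ψ_n` in ANY
  extension is `Ψ_n` — `2ⁿ = [ℚ(θ):ℚ]` divides `[K(θ):ℚ] = [K:ℚ]·[K(θ):K]` with `[K:ℚ]` odd, so `2ⁿ ∣ [K(θ):K] ≤ 2ⁿ`; hence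
  `irreducible_of_odd_finrank`, `finrank_adjoin_eq_of_odd_finrank` (`[K(θ):K] = 2ⁿ`), **`nonempty_algEquiv_of_root_of_odd_finrank`** (two
  extensions of degree `2ⁿ` each with a root are `K`-isomorphic: both are `K[X]/(Ψ_n)`), `iterate_ne_zero_of_odd_finrank` (no root in `K`).
* §4 (roots of unity) `iterate_add_inv` (`Ψ_n(ζ + ζ⁻¹) = ζ^{2ⁿ} + ζ^{−2ⁿ}`), **`iterate_add_inv_eq_zero`**: for a primitive `2^{n+2}`-th root of
  unity `ζ`, `Ψ_n(ζ + ζ⁻¹) = 0` (`ζ^{2ⁿ} = ±i`); `iterate_add_inv_eq_zero_of_pow_eq_neg_one`.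

These are the inputs of the layer models `K_n ≅ K(θ_n)` of the cyclotomic `ℤ₂`-extension of an odd-degree number field
(`IwasawaTheory/NarrowFukudaCertificateLayerPolynomialModels.lean`, this seat) — Washington's `ℚ_n = ℚ(ζ_{2^{n+2}})⁺`, `K_n = Kℚ_n`.

References: [Washington1997] L. C. Washington, *Introduction to Cyclotomic Fields*, 2nd ed., §13.1 (`ℚ_n = ℚ(ζ_{2^{n+2}})⁺`), Prop. 2.16
/ Lemma 1.4 type computations (`2cos(2π/2^{n+2})`); [Lang2002] S. Lang, *Algebra*, IV §3 (Eisenstein's criterion, Gauss's lemma);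
[NeukirchANT1999] Ch. I §2 (integrality).  Design: proofs only; `noncomputable section`; file-local helpers `private`.
-/

set_option autoImplicit false

noncomputable section

open scoped Polynomial IntermediateField
open Polynomial

namespace Literature.NumberTheory.NumberFields.NestedSqrtTwo

/-! ## §1 The recursion, evaluation, base change, degree -/

section CommRing

variable {R : Type*} [CommRing R]

/-- `Ψ_0 = X`. [cite: Washington1997, §13.1] -/
theorem iterate_zero : ((X ^ 2 - C 2 : R[X]).comp)^[0] X = X := rfl

/-- **`Ψ_{n+1} = Ψ_n² − 2`.** [cite: Washington1997, §13.1] -/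
theorem iterate_succ (n : ℕ) :
    ((X ^ 2 - C 2 : R[X]).comp)^[n + 1] X = (((X ^ 2 - C 2 : R[X]).comp)^[n] X) ^ 2 - C 2 := by
  rw [Function.iterate_succ_apply', sub_comp, pow_comp, X_comp, C_comp]

/-- `Ψ_1 = X² − 2` (`ℚ_1 = ℚ(√2)`). [cite: Washington1997, §13.1] -/
theorem iterate_one : ((X ^ 2 - C 2 : R[X]).comp)^[1] X = X ^ 2 - C 2 := by
  rw [iterate_succ, iterate_zero]

/-- `Ψ_2 = X⁴ − 4X² + 2`. [cite: Washington1997, §13.1] -/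
theorem iterate_two : ((X ^ 2 - C 2 : R[X]).comp)^[2] X = X ^ 4 - C 4 * X ^ 2 + C 2 := by
  rw [iterate_succ, iterate_one]
  simp only [map_ofNat]
  ring

/-- `Ψ_3 = X⁸ − 8X⁶ + 20X⁴ − 16X² + 2`. [cite: Washington1997, §13.1] -/
theorem iterate_three :
    ((X ^ 2 - C 2 : R[X]).comp)^[3] X = X ^ 8 - C 8 * X ^ 6 + C 20 * X ^ 4 - C 16 * X ^ 2 + C 2 := by
  rw [iterate_succ, iterate_two]
  simp only [map_ofNat]
  ring

/-- **Evaluation: `Ψ_n(θ) = (x ↦ x² − 2)^{∘n}(θ)`** — «`θ` is a root of `Ψ_n`» is `(fun x => x ^ 2 - 2)^[n] θ = 0`. [cite: Washington1997, §13.1] -/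
theorem aeval_eq_iterate {A : Type*} [CommRing A] [Algebra R A] (θ : A) (n : ℕ) :
    aeval θ (((X ^ 2 - C 2 : R[X]).comp)^[n] X) = (fun x : A => x ^ 2 - 2)^[n] θ := by
  induction n with
  | zero => simp
  | succ n ih =>
    rw [iterate_succ, Function.iterate_succ_apply', map_sub, map_pow, ih, aeval_C, map_ofNat]

/-- Evaluation in `R` itself: `Ψ_n(x) = (x ↦ x² − 2)^{∘n}(x)`. [cite: Washington1997, §13.1] -/
theorem eval_eq_iterate (x : R) (n : ℕ) :
    eval x (((X ^ 2 - C 2 : R[X]).comp)^[n] X) = (fun x : R => x ^ 2 - 2)^[n] x := by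
  rw [← aeval_eq_iterate (R := R) x n, coe_aeval_eq_eval]

/-- **Ring homomorphisms commute with `x ↦ x² − 2` and its iterates.** [cite: Washington1997, §13.1] -/
theorem map_iterate {A B : Type*} [CommRing A] [CommRing B] (φ : A →+* B) (x : A) (n : ℕ) :
    φ ((fun x : A => x ^ 2 - 2)^[n] x) = (fun x : B => x ^ 2 - 2)^[n] (φ x) := by
  have h : Function.Semiconj φ (fun x : A => x ^ 2 - 2) (fun x : B => x ^ 2 - 2) := fun y => by
    simp only [map_sub, map_pow, map_ofNat]
  exact h.iterate_right n x

/-- **Base change: `Ψ_n` over `R` maps to `Ψ_n` over `S`.** [cite: Washington1997, §13.1] -/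
theorem map_eq {S : Type*} [CommRing S] (φ : R →+* S) (n : ℕ) :
    (((X ^ 2 - C 2 : R[X]).comp)^[n] X).map φ = ((X ^ 2 - C 2 : S[X]).comp)^[n] X := by
  induction n with
  | zero => simp
  | succ n ih =>
    rw [iterate_succ, iterate_succ, Polynomial.map_sub, Polynomial.map_pow, ih, map_C, map_ofNat φ 2]

variable [Nontrivial R]

/-- **`Ψ_n` is monic of degree `2ⁿ`** (both at once, by induction). [cite: Washington1997, §13.1 (`[ℚ_n : ℚ] = 2ⁿ`)] -/
theorem monic_and_natDegree_eq (n : ℕ) :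
    (((X ^ 2 - C 2 : R[X]).comp)^[n] X).Monic ∧ (((X ^ 2 - C 2 : R[X]).comp)^[n] X).natDegree = 2 ^ n := by
  induction n with
  | zero => exact ⟨monic_X, natDegree_X⟩
  | succ n ih =>
    obtain ⟨hm, hd⟩ := ih
    have hd2 : ((((X ^ 2 - C 2 : R[X]).comp)^[n] X) ^ 2).natDegree = 2 ^ (n + 1) := by
      rw [hm.natDegree_pow, hd, pow_succ, mul_comm]
    have hlt' : (C (2 : R)).natDegree < ((((X ^ 2 - C 2 : R[X]).comp)^[n] X) ^ 2).natDegree := by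
      rw [natDegree_C, hd2]; positivity
    have hlt : degree (C (2 : R)) < degree ((((X ^ 2 - C 2 : R[X]).comp)^[n] X) ^ 2) := degree_lt_degree hlt'
    refine ⟨?_, ?_⟩
    · rw [iterate_succ]; exact (hm.pow 2).sub_of_left hlt
    · rw [iterate_succ, natDegree_sub_eq_left_of_natDegree_lt hlt', hd2]

/-- `Ψ_n` is monic. [cite: Washington1997, §13.1] -/
theorem monic (n : ℕ) : (((X ^ 2 - C 2 : R[X]).comp)^[n] X).Monic := (monic_and_natDegree_eq n).1

/-- `deg Ψ_n = 2ⁿ`. [cite: Washington1997, §13.1 (`[ℚ_n : ℚ] = 2ⁿ`)] -/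
theorem natDegree_eq (n : ℕ) : (((X ^ 2 - C 2 : R[X]).comp)^[n] X).natDegree = 2 ^ n := (monic_and_natDegree_eq n).2

/-- `Ψ_n ≠ 0`. [cite: Washington1997, §13.1] -/
theorem ne_zero (n : ℕ) : ((X ^ 2 - C 2 : R[X]).comp)^[n] X ≠ 0 := (monic n).ne_zero

/-- A root of `Ψ_n` is integral over the base (`Ψ_n` is monic). [cite: Washington1997, §13.1] [cite: NeukirchANT1999, Ch. I §2] -/
theorem isIntegral {A : Type*} [CommRing A] [Algebra R A] {θ : A} {n : ℕ} (hθ : (fun x : A => x ^ 2 - 2)^[n] θ = 0) :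
    IsIntegral R θ :=
  ⟨_, monic n, by rw [← aeval_def, aeval_eq_iterate, hθ]⟩

end CommRing

/-! ## §2 Over `ℤ`: `Ψ_{n+1} ≡ X^{2^{n+1}} (mod 2)` with constant term `±2` — Eisenstein at `2` -/

section Int

/-- **`Ψ_{n+1} = X^{2^{n+1}} + 2q` with `q(0)² = 1`** (`q(0) = −1` for `n = 0`, `q(0) = 1` afterwards: `q' = 2X^{2^{n+1}}q + 2q² − 1`).
[cite: Washington1997, §13.1] -/
theorem exists_eq_X_pow_add_C_two_mul (n : ℕ) :
    ∃ q : ℤ[X], ((X ^ 2 - C 2 : ℤ[X]).comp)^[n + 1] X = X ^ 2 ^ (n + 1) + C 2 * q ∧ q.coeff 0 ^ 2 = 1 := by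
  induction n with
  | zero => exact ⟨-1, by rw [iterate_one]; ring, by simp⟩
  | succ n ih =>
    obtain ⟨q, hq, hq0⟩ := ih
    refine ⟨C 2 * X ^ 2 ^ (n + 1) * q + C 2 * q ^ 2 - 1, ?_, ?_⟩
    · rw [iterate_succ, hq]
      simp only [map_ofNat]
      have hX : (X ^ 2 ^ (n + 1) : ℤ[X]) ^ 2 = X ^ 2 ^ (n + 1 + 1) := by rw [← pow_mul, ← pow_succ]
      rw [← hX]
      ring
    · rw [coeff_zero_eq_eval_zero] at hq0 ⊢
      simp only [eval_sub, eval_add, eval_mul, eval_C, eval_pow, eval_X, eval_one,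
        zero_pow (pow_ne_zero _ two_ne_zero), mul_zero, zero_mul, zero_add]
      nlinarith [hq0]

/-- **`Ψ_{n+1} ∈ ℤ[X]` is Eisenstein at `2`**: monic, every non-leading coefficient even, constant term `±2 ∉ 4ℤ`.
[cite: Washington1997, §13.1] [cite: Lang2002, IV §3] -/
theorem isEisensteinAt_two (n : ℕ) :
    (((X ^ 2 - C 2 : ℤ[X]).comp)^[n + 1] X).IsEisensteinAt (Ideal.span {(2 : ℤ)}) := by
  obtain ⟨q, hq, hq0⟩ := exists_eq_X_pow_add_C_two_mul n
  have hP : (Ideal.span {(2 : ℤ)}).IsPrime := (Ideal.span_singleton_prime two_ne_zero).mpr Int.prime_two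
  refine (monic (R := ℤ) (n + 1)).isEisensteinAt_of_mem_of_notMem hP.ne_top ?_ ?_
  · intro k hk
    rw [natDegree_eq] at hk
    rw [hq, coeff_add, coeff_X_pow, if_neg hk.ne, zero_add, coeff_C_mul, Ideal.mem_span_singleton]
    exact dvd_mul_right 2 _
  · rw [hq, coeff_add, coeff_X_pow, if_neg (pow_ne_zero _ two_ne_zero).symm, zero_add, coeff_C_mul,
      Ideal.span_singleton_pow, Ideal.mem_span_singleton]
    rintro ⟨c, hc⟩
    have h2 : (2 : ℤ) ∣ q.coeff 0 := ⟨c, by linarith⟩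
    obtain ⟨d, hd⟩ := h2
    rw [hd] at hq0
    have : (2 : ℤ) ∣ 1 := ⟨2 * d ^ 2, by linear_combination (-1 : ℤ) * hq0⟩
    omega

/-- **`Ψ_n` is irreducible in `ℤ[X]`** (`n = 0`: `X`; `n ≥ 1`: Eisenstein at `2`). [cite: Washington1997, §13.1] [cite: Lang2002, IV §3] -/
theorem irreducible_int (n : ℕ) : Irreducible (((X ^ 2 - C 2 : ℤ[X]).comp)^[n] X) := by
  cases n with
  | zero => exact irreducible_X
  | succ n =>
    have hP : (Ideal.span {(2 : ℤ)}).IsPrime := (Ideal.span_singleton_prime two_ne_zero).mpr Int.prime_two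
    exact (isEisensteinAt_two n).irreducible hP (monic (R := ℤ) (n + 1)).isPrimitive
      (by rw [natDegree_eq]; positivity)

/-- **`Ψ_n` is irreducible over `ℚ`** (Gauss's lemma). [cite: Washington1997, §13.1 (`[ℚ(ζ_{2^{n+2}} + ζ_{2^{n+2}}⁻¹) : ℚ] = 2ⁿ`)] [cite: Lang2002, IV §3] -/
theorem irreducible_rat (n : ℕ) : Irreducible (((X ^ 2 - C 2 : ℚ[X]).comp)^[n] X) := by
  have h := (IsPrimitive.Int.irreducible_iff_irreducible_map_cast (monic (R := ℤ) n).isPrimitive).mp (irreducible_int n)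
  rwa [map_eq] at h

/-- **The minimal polynomial over `ℚ` of a root of `Ψ_n` (in any field of characteristic `0`, any `ℚ`-algebra structure) is `Ψ_n`.**
[cite: Washington1997, §13.1] -/
theorem minpoly_rat_eq {L : Type*} [Field L] [Algebra ℚ L] {θ : L} {n : ℕ} (hθ : (fun x : L => x ^ 2 - 2)^[n] θ = 0) :
    minpoly ℚ θ = ((X ^ 2 - C 2 : ℚ[X]).comp)^[n] X :=
  (minpoly.eq_of_irreducible_of_monic (irreducible_rat n) (by rw [aeval_eq_iterate, hθ]) (monic n)).symm

/-- `[ℚ(θ) : ℚ] = 2ⁿ` for a root `θ` of `Ψ_n`. [cite: Washington1997, §13.1 (`[ℚ_n : ℚ] = 2ⁿ`)] -/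
theorem finrank_rat_adjoin_eq {L : Type*} [Field L] [Algebra ℚ L] {θ : L} {n : ℕ} (hθ : (fun x : L => x ^ 2 - 2)^[n] θ = 0) :
    Module.finrank ℚ ℚ⟮θ⟯ = 2 ^ n := by
  rw [IntermediateField.adjoin.finrank (isIntegral hθ), minpoly_rat_eq hθ, natDegree_eq]

end Int

/-! ## §3 Over a number field of odd degree: `Ψ_n` stays irreducible -/

section OddDegree

variable {K : Type*} [Field K] [NumberField K]

/-- **The minimal polynomial over an ODD-degree number field `K` of any root `θ` of `Ψ_n` (in any field extension of `K`) is `Ψ_n`.**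
Degree count in `K(θ)`, made a `ℚ`-algebra through `K`: `2ⁿ = [ℚ(θ):ℚ]` divides `[K(θ):ℚ] = [K:ℚ]·[K(θ):K]`, and `[K:ℚ]` is odd, so
`2ⁿ ∣ [K(θ):K] = deg minpoly_K(θ) ≤ deg Ψ_n = 2ⁿ`.  (Washington: `K ∩ ℚ_∞ = ℚ` for `[K:ℚ]` odd, so `[Kℚ_n : K] = 2ⁿ`.)
[cite: Washington1997, §13.1] -/
theorem minpoly_eq_of_odd_finrank (hodd : Odd (Module.finrank ℚ K)) {L : Type*} [Field L] [Algebra K L] (θ : L) {n : ℕ}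
    (hθ : (fun x : L => x ^ 2 - 2)^[n] θ = 0) : minpoly K θ = ((X ^ 2 - C 2 : K[X]).comp)^[n] X := by
  have hint : IsIntegral K θ := isIntegral hθ
  have hdvd : minpoly K θ ∣ ((X ^ 2 - C 2 : K[X]).comp)^[n] X := minpoly.dvd K θ (by rw [aeval_eq_iterate, hθ])
  have hle : (minpoly K θ).natDegree ≤ 2 ^ n :=
    (natDegree_eq (R := K) n) ▸ natDegree_le_of_dvd hdvd (ne_zero n)
  suffices hdeg : (minpoly K θ).natDegree = 2 ^ n by
    symm
    exact eq_of_monic_of_dvd_of_natDegree_le (minpoly.monic hint) (monic n) hdvd (by rw [natDegree_eq, hdeg])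
  -- `L` (hence `M = K(θ)`) has characteristic `0`, so it is canonically a `ℚ`-algebra, compatibly with `K`
  haveI : CharZero L := charZero_of_injective_algebraMap (algebraMap K L).injective
  haveI : FiniteDimensional K K⟮θ⟯ := IntermediateField.adjoin.finiteDimensional hint
  haveI : FiniteDimensional ℚ K⟮θ⟯ := Module.Finite.trans K K⟮θ⟯
  -- the generator, a root of `Ψ_n` in `M`
  set θ' : K⟮θ⟯ := IntermediateField.AdjoinSimple.gen K θ with hθ'def
  have hθ' : (fun x : K⟮θ⟯ => x ^ 2 - 2)^[n] θ' = 0 := by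
    have hval : (algebraMap K⟮θ⟯ L) ((fun x : K⟮θ⟯ => x ^ 2 - 2)^[n] θ') = 0 := by
      rw [map_iterate, hθ'def, IntermediateField.AdjoinSimple.algebraMap_gen K θ, hθ]
    exact (map_eq_zero_iff _ (algebraMap K⟮θ⟯ L).injective).mp hval
  have hintQ : IsIntegral ℚ θ' := isIntegral hθ'
  -- `2ⁿ = [ℚ(θ') : ℚ]` divides `[M : ℚ] = [K : ℚ]·[M : K]`
  have h1 : Module.finrank ℚ ℚ⟮θ'⟯ = 2 ^ n := finrank_rat_adjoin_eq hθ'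
  have h2 : Module.finrank ℚ ℚ⟮θ'⟯ ∣ Module.finrank ℚ K⟮θ⟯ :=
    ⟨Module.finrank ℚ⟮θ'⟯ K⟮θ⟯, (Module.finrank_mul_finrank ℚ ℚ⟮θ'⟯ K⟮θ⟯).symm⟩
  have h3 : Module.finrank ℚ K⟮θ⟯ = Module.finrank ℚ K * Module.finrank K K⟮θ⟯ :=
    (Module.finrank_mul_finrank ℚ K K⟮θ⟯).symm
  have h4 : Module.finrank K K⟮θ⟯ = (minpoly K θ).natDegree := IntermediateField.adjoin.finrank hint
  have h5 : 2 ^ n ∣ Module.finrank ℚ K * (minpoly K θ).natDegree := by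
    rw [← h4, ← h3, ← h1]; exact h2
  have h6 : 2 ^ n ∣ (minpoly K θ).natDegree :=
    (Nat.Coprime.pow_left n (Nat.coprime_two_left.mpr hodd)).dvd_of_dvd_mul_left h5
  exact le_antisymm hle (Nat.le_of_dvd (minpoly.natDegree_pos hint) h6)

/-- **`Ψ_n` is irreducible over every number field of odd degree.** [cite: Washington1997, §13.1] -/
theorem irreducible_of_odd_finrank (hodd : Odd (Module.finrank ℚ K)) (n : ℕ) :
    Irreducible (((X ^ 2 - C 2 : K[X]).comp)^[n] X) := by
  obtain ⟨θ, hθ⟩ := IsAlgClosed.exists_aeval_eq_zero (AlgebraicClosure K) (((X ^ 2 - C 2 : K[X]).comp)^[n] X)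
    (by rw [degree_eq_natDegree (ne_zero n), natDegree_eq]; exact_mod_cast pow_ne_zero n two_ne_zero)
  rw [aeval_eq_iterate] at hθ
  rw [← minpoly_eq_of_odd_finrank hodd θ hθ]
  exact minpoly.irreducible (isIntegral hθ)

/-- **`[K(θ) : K] = 2ⁿ`** for a root `θ` of `Ψ_n` over an odd-degree number field `K`. [cite: Washington1997, §13.1 (`[K_n : K] = 2ⁿ`)] -/
theorem finrank_adjoin_eq_of_odd_finrank (hodd : Odd (Module.finrank ℚ K)) {L : Type*} [Field L] [Algebra K L] (θ : L) {n : ℕ}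
    (hθ : (fun x : L => x ^ 2 - 2)^[n] θ = 0) : Module.finrank K K⟮θ⟯ = 2 ^ n := by
  rw [IntermediateField.adjoin.finrank (isIntegral hθ), minpoly_eq_of_odd_finrank hodd θ hθ, natDegree_eq]

/-- `Ψ_n` has no root in an odd-degree number field, `n ≥ 1`. [cite: Washington1997, §13.1 (`K ∩ ℚ_∞ = ℚ`)] -/
theorem iterate_ne_zero_of_odd_finrank (hodd : Odd (Module.finrank ℚ K)) {n : ℕ} (hn : 1 ≤ n) (x : K) :
    (fun x : K => x ^ 2 - 2)^[n] x ≠ 0 := by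
  intro hx
  have h := finrank_adjoin_eq_of_odd_finrank hodd (L := K) x hx
  have h1 : Module.finrank K K⟮x⟯ = 1 := by
    rw [IntermediateField.adjoin.finrank (isIntegral hx), minpoly.eq_X_sub_C', natDegree_X_sub_C]
  rw [h1] at h
  have : 2 ≤ 2 ^ n := by
    calc (2 : ℕ) = 2 ^ 1 := by norm_num
      _ ≤ 2 ^ n := Nat.pow_le_pow_right two_pos hn
  omega

/-- A degree-`2ⁿ` extension of an odd-degree number field `K` containing a root of `Ψ_n` is `K[X]/(Ψ_n)`. [cite: Washington1997, §13.1] -/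
private theorem nonempty_algEquiv_adjoinRoot_of_root (hodd : Odd (Module.finrank ℚ K))
    {L : Type*} [Field L] [Algebra K L] [FiniteDimensional K L] {n : ℕ} (hL : Module.finrank K L = 2 ^ n) (θ : L)
    (hθ : (fun x : L => x ^ 2 - 2)^[n] θ = 0) :
    Nonempty (AdjoinRoot (((X ^ 2 - C 2 : K[X]).comp)^[n] X) ≃ₐ[K] L) := by
  have hint : IsIntegral K θ := isIntegral hθ
  have hmin : ((X ^ 2 - C 2 : K[X]).comp)^[n] X = minpoly K θ := (minpoly_eq_of_odd_finrank hodd θ hθ).symm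
  have htop : K⟮θ⟯ = ⊤ := by
    apply IntermediateField.eq_of_le_of_finrank_eq le_top
    rw [finrank_adjoin_eq_of_odd_finrank hodd θ hθ, IntermediateField.finrank_top', hL]
  exact ⟨(AdjoinRoot.algEquivOfEq K _ _ hmin).trans
    ((IntermediateField.adjoinRootEquivAdjoin K hint).trans ((IntermediateField.equivOfEq htop).trans IntermediateField.topEquiv))⟩

/-- **Two extensions of degree `2ⁿ` of an odd-degree number field `K`, each containing a root of `Ψ_n`, are `K`-isomorphic** (both are
`K[X]/(Ψ_n)` — models of the layer `K_n = Kℚ_n` of the cyclotomic `ℤ₂`-extension). [cite: Washington1997, §13.1 (`K_n = Kℚ_n`)] -/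
theorem nonempty_algEquiv_of_root_of_odd_finrank (hodd : Odd (Module.finrank ℚ K)) {n : ℕ}
    {L₁ L₂ : Type*} [Field L₁] [Algebra K L₁] [FiniteDimensional K L₁] [Field L₂] [Algebra K L₂] [FiniteDimensional K L₂]
    (h₁ : Module.finrank K L₁ = 2 ^ n) (θ₁ : L₁) (hθ₁ : (fun x : L₁ => x ^ 2 - 2)^[n] θ₁ = 0)
    (h₂ : Module.finrank K L₂ = 2 ^ n) (θ₂ : L₂) (hθ₂ : (fun x : L₂ => x ^ 2 - 2)^[n] θ₂ = 0) : Nonempty (L₁ ≃ₐ[K] L₂) := by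
  obtain ⟨e₁⟩ := nonempty_algEquiv_adjoinRoot_of_root hodd h₁ θ₁ hθ₁
  obtain ⟨e₂⟩ := nonempty_algEquiv_adjoinRoot_of_root hodd h₂ θ₂ hθ₂
  exact ⟨e₁.symm.trans e₂⟩

end OddDegree

/-! ## §4 The roots: `Ψ_n(ζ + ζ⁻¹) = 0` for a primitive `2^{n+2}`-th root of unity `ζ` -/

section RootsOfUnity

variable {F : Type*} [Field F]

/-- **`Ψ_n(ζ + ζ⁻¹) = ζ^{2ⁿ} + ζ^{−2ⁿ}`** (`ζ ≠ 0`; `(x + x⁻¹)² − 2 = x² + x⁻²`). [cite: Washington1997, §13.1] -/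
theorem iterate_add_inv {ζ : F} (hζ : ζ ≠ 0) (n : ℕ) :
    (fun x : F => x ^ 2 - 2)^[n] (ζ + ζ⁻¹) = ζ ^ 2 ^ n + (ζ ^ 2 ^ n)⁻¹ := by
  induction n generalizing ζ with
  | zero => simp
  | succ n ih =>
    have hstep : (ζ + ζ⁻¹) ^ 2 - 2 = ζ ^ 2 + (ζ ^ 2)⁻¹ := by
      field_simp
      ring
    rw [Function.iterate_succ_apply, hstep, ih (pow_ne_zero 2 hζ), ← pow_mul, ← pow_succ']

/-- **`Ψ_n(ζ + ζ⁻¹) = 0` for a primitive `2^{n+2}`-th root of unity `ζ`**: `η = ζ^{2ⁿ}` is a primitive fourth root of unity, `η² = −1`,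
`η + η⁻¹ = 0`.  So `2cos(π/2^{n+1}) = ζ_{2^{n+2}} + ζ_{2^{n+2}}⁻¹` is a root of `Ψ_n`, and (`§2`) `Ψ_n` is its minimal polynomial over `ℚ`:
`ℚ(ζ_{2^{n+2}})⁺ = ℚ(ζ + ζ⁻¹)` has degree `2ⁿ`. [cite: Washington1997, §13.1 (`ℚ_n = ℚ(ζ_{2^{n+2}})⁺`)] -/
theorem iterate_add_inv_eq_zero {ζ : F} {n : ℕ} (hζ : IsPrimitiveRoot ζ (2 ^ (n + 2))) :
    (fun x : F => x ^ 2 - 2)^[n] (ζ + ζ⁻¹) = 0 := by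
  have hζ0 : ζ ≠ 0 := hζ.ne_zero (pow_ne_zero _ two_ne_zero)
  rw [iterate_add_inv hζ0 n]
  set η : F := ζ ^ 2 ^ n with hη
  have h4 : η ^ 4 = 1 := by
    rw [hη, ← pow_mul, show 2 ^ n * 4 = 2 ^ (n + 2) by ring]; exact hζ.pow_eq_one
  have h2 : η ^ 2 ≠ 1 := by
    rw [hη, ← pow_mul, show 2 ^ n * 2 = 2 ^ (n + 1) by ring]
    exact hζ.pow_ne_one_of_pos_of_lt (by positivity) (Nat.pow_lt_pow_right (by norm_num) (by omega))
  have hsq : η ^ 2 * η ^ 2 = 1 := by rw [← pow_add]; exact h4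
  have hneg : η ^ 2 = -1 := by
    rcases mul_self_eq_one_iff.mp hsq with h | h
    · exact (h2 h).elim
    · exact h
  have hinv : η⁻¹ = -η := by
    symm; refine eq_inv_of_mul_eq_one_left ?_
    linear_combination (-1 : F) * hneg
  rw [hinv, add_neg_cancel]

/-- The same for the power `ζ^k`-free formulation used by consumers: if `ζ^{2^{n+1}} = −1` then `Ψ_n(ζ + ζ⁻¹) = 0`. [cite: Washington1997, §13.1] -/
theorem iterate_add_inv_eq_zero_of_pow_eq_neg_one {ζ : F} {n : ℕ} (hζ : ζ ^ 2 ^ (n + 1) = -1) :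
    (fun x : F => x ^ 2 - 2)^[n] (ζ + ζ⁻¹) = 0 := by
  have hζ0 : ζ ≠ 0 := by
    rintro rfl
    rw [zero_pow (pow_ne_zero _ two_ne_zero)] at hζ
    exact zero_ne_one (by linear_combination (-1 : F) * hζ)
  rw [iterate_add_inv hζ0 n]
  set η : F := ζ ^ 2 ^ n with hη
  have hneg : η ^ 2 = -1 := by rw [hη, ← pow_mul, show 2 ^ n * 2 = 2 ^ (n + 1) by ring]; exact hζ
  have hinv : η⁻¹ = -η := by
    symm; refine eq_inv_of_mul_eq_one_left ?_
    linear_combination (-1 : F) * hneg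
  rw [hinv, add_neg_cancel]

end RootsOfUnity

end Literature.NumberTheory.NumberFields.NestedSqrtTwo

end
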